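import Summits.ValiantsHypothesis.ValiantsHypothesis.Theorems.BarrierLeverAnchoredDoorHitsLowerPairsStarFacePivot
import Summits.ValiantsHypothesis.ValiantsHypothesis.Theorems.BarrierLeverAnchoredDoorHitsLowerPairsStarArrow

/-!
# Route BarrierLever — support item `AnchoredDoorHitsLowerPairs` (stmt-ValiantsHypothesis-22510), line `anchored_peeling`:
# STAR-LOWER REDUCES TO VERTEX–FACE-RIGID PAIRS (val-np-p1 g32)

A BY-NAME NARROWING of the door slot of record `Stmt.conjStarLower` (…StarDoor, p725521). Call an equal-size pair of families `(u, w)`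
VERTEX–FACE RIGID (`StarDoor.IsFaceRigid`) when no row vertex `b₀` lying in some row has as many rows through it as some set `T` of column
vertices has columns containing it, and symmetrically no column vertex `e₀` against any set `A₀` of row vertices. If `(u, w)` is NOT rigid, the
FACE PIVOT (…StarFacePivot, p742818/p742891: `StarDoor.starDet_ne_zero_of_facePivot[_swap]`) reduces a nonsingular star-forest block for `(u, w)`
to nonsingular blocks for the LINK pair and the DELETION pair, which are again injective LOWER pairs of strictly smaller size when `(u, w)` is an
injective lower pair (`r ≥ 1` forces the empty row, through which no vertex passes). Strong induction on `r` gives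

* `conjStarLower_of_conjStarRigid : Stmt.conjStarRigid → Stmt.conjStarLower`, where
* `Stmt.conjStarRigid` := STAR-LOWER restricted to vertex–face-rigid injective lower pairs (node text, offered under D-0145), and hence
* `anchoredDoorHitsLowerPairs_of_conjStarRigid : Stmt.conjStarRigid → AnchoredDoorHitsLowerPairs` (via …StarArrow).

CENSUS of record (HOME/val-np-p1/g32, lab/rigid.py / rigid2.py): vertex–face-rigid ordered lower pairs on `5+5` vertices: 80 of 1 798
(4+5: 13/121, 4+4: 0/40, 3+4: 1/7 — (K₃, 2K₂), which is evaluation-good); every one of them is certified numerically by g31's evaluation-face /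
vertex–facet classes, so the node is census-clean. WHY IT MIGHT FAIL: a rigid lower pair on which every star-forest block is singular.
This file does NOT prove `Stmt.conjStarLower`; nothing here bears on crux 14610 or on `VP ≠ VNP`.
-/

set_option linter.dupNamespace false

namespace Summit.ValiantsHypothesis.ValiantsHypothesis.Theorems.BarrierLever.AnchoredPeeling

open Finset

noncomputable section

namespace StarDoor

variable {h : ℕ}

/-- **Vertex–face rigidity.** No row vertex `b₀` (lying in some row) is BALANCED against a set `T` of column vertices — as many rows contain
`b₀` as columns contain `T` — and no column vertex `e₀` (lying in some column) is balanced against a set `A₀` of row vertices. -/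
def IsFaceRigid {r : ℕ} (u w : Fin r → Finset (Fin h)) : Prop :=
  (∀ (b₀ : Fin h) (T : Finset (Fin h)), (∃ i, b₀ ∈ u i) →
      (Finset.univ.filter fun i => b₀ ∈ u i).card ≠ (Finset.univ.filter fun j => T ⊆ w j).card) ∧
  (∀ (e₀ : Fin h) (A₀ : Finset (Fin h)), (∃ j, e₀ ∈ w j) →
      (Finset.univ.filter fun j => e₀ ∈ w j).card ≠ (Finset.univ.filter fun i => A₀ ⊆ u i).card)

section Step

variable {r : ℕ} (u w : Fin r → Finset (Fin h))

/-- A permutation matching the columns containing `T` with the rows containing `b₀`, from equal counts. -/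
theorem exists_matching_perm (b₀ : Fin h) (T : Finset (Fin h))
    (hcard : (Finset.univ.filter fun i => b₀ ∈ u i).card = (Finset.univ.filter fun j => T ⊆ w j).card) :
    ∃ σ : Equiv.Perm (Fin r), ∀ j, T ⊆ w (σ j) ↔ b₀ ∈ u j := by
  classical
  have h1 : Fintype.card {i : Fin r // b₀ ∈ u i} = Fintype.card {j : Fin r // T ⊆ w j} := by
    rw [Fintype.card_subtype, Fintype.card_subtype]; exact hcard
  have h2 : Fintype.card {i : Fin r // ¬ b₀ ∈ u i} = Fintype.card {j : Fin r // ¬ T ⊆ w j} := by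
    rw [Fintype.card_subtype_compl, Fintype.card_subtype_compl, h1]
  let e₁ : {i : Fin r // b₀ ∈ u i} ≃ {j : Fin r // T ⊆ w j} := Fintype.equivOfCardEq h1
  let e₂ : {i : Fin r // ¬ b₀ ∈ u i} ≃ {j : Fin r // ¬ T ⊆ w j} := Fintype.equivOfCardEq h2
  refine ⟨Equiv.subtypeCongr e₁ e₂, fun j => ?_⟩
  by_cases hj : b₀ ∈ u j
  · have : (Equiv.subtypeCongr e₁ e₂) j = (e₁ ⟨j, hj⟩ : Fin r) := by
      simp only [Equiv.subtypeCongr, Equiv.trans_apply]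
      rw [Equiv.sumCompl_symm_apply_of_pos (p := fun x => b₀ ∈ u x) hj, Equiv.sumCongr_apply, Sum.map_inl,
        Equiv.sumCompl_apply_inl]
    rw [this]
    exact iff_of_true (e₁ ⟨j, hj⟩).2 hj
  · have : (Equiv.subtypeCongr e₁ e₂) j = (e₂ ⟨j, hj⟩ : Fin r) := by
      simp only [Equiv.subtypeCongr, Equiv.trans_apply]
      rw [Equiv.sumCompl_symm_apply_of_neg (p := fun x => b₀ ∈ u x) hj, Equiv.sumCongr_apply, Sum.map_inr,
        Equiv.sumCompl_apply_inr]
    rw [this]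
    exact iff_of_false (e₂ ⟨j, hj⟩).2 hj

/-- **The inductive step (row side).** If every injective lower pair of size `< r` has a nonsingular star-forest block, then so does an
injective lower pair of size `r` admitting a balanced row vertex `b₀` against a column vertex set `T`. -/
theorem starDet_ne_zero_of_balanced_row
    (IH : ∀ m < r, ∀ (u' w' : Fin m → Finset (Fin h)), Function.Injective u' → Function.Injective w' →
      IsLowerSet (Set.range u') → IsLowerSet (Set.range w') →
      ∃ g d : Fin h → Fin h → ℂ, (Matrix.of fun i j : Fin m => starEntry g d (u' i) (w' j)).det ≠ 0)
    (hu : Function.Injective u) (hw : Function.Injective w) (hlu : IsLowerSet (Set.range u)) (hlw : IsLowerSet (Set.range w))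
    (b₀ : Fin h) (T : Finset (Fin h)) (hb₀ : ∃ i, b₀ ∈ u i)
    (hcard : (Finset.univ.filter fun i => b₀ ∈ u i).card = (Finset.univ.filter fun j => T ⊆ w j).card) :
    ∃ g d : Fin h → Fin h → ℂ, (Matrix.of fun i j : Fin r => starEntry g d (u i) (w j)).det ≠ 0 := by
  classical
  obtain ⟨σ, hσ⟩ := exists_matching_perm u w b₀ T hcard
  obtain ⟨i₁, hi₁⟩ := hb₀
  -- the empty row: through it passes no vertex
  obtain ⟨i₀, hi₀⟩ : ∃ i₀, u i₀ = ∅ := by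
    obtain ⟨i₀, hi₀⟩ := hlu (show (∅ : Finset (Fin h)) ≤ u i₁ from Finset.empty_subset _) ⟨i₁, rfl⟩
    exact ⟨i₀, hi₀⟩
  have hni₀ : b₀ ∉ u i₀ := by rw [hi₀]; exact Finset.notMem_empty _
  -- sizes of the two sub-pairs
  set k := Fintype.card {i : Fin r // b₀ ∈ u i} with hk
  set m₀ := Fintype.card {i : Fin r // ¬ b₀ ∈ u i} with hm₀
  have hkr : k < r := by
    have := Fintype.card_subtype_lt (p := fun i : Fin r => b₀ ∈ u i) (x := i₀) hni₀
    rwa [Fintype.card_fin] at this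
  have hm₀r : m₀ < r := by
    have := Fintype.card_subtype_lt (p := fun i : Fin r => ¬ b₀ ∈ u i) (x := i₁) (not_not.mpr hi₁)
    rwa [Fintype.card_fin] at this
  let eL : {i : Fin r // b₀ ∈ u i} ≃ Fin k := Fintype.equivFin _
  let eD : {i : Fin r // ¬ b₀ ∈ u i} ≃ Fin m₀ := Fintype.equivFin _
  -- the LINK pair
  let uL : Fin k → Finset (Fin h) := fun m => (u (eL.symm m)).erase b₀
  let wL : Fin k → Finset (Fin h) := fun m => (w (σ (eL.symm m))) \ T
  have huL : Function.Injective uL := by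
    intro m m' hmm'
    have h1 : u (eL.symm m) = u (eL.symm m') := by
      have := congrArg (insert b₀) hmm'
      simp only [uL, Finset.insert_erase (eL.symm m).2, Finset.insert_erase (eL.symm m').2] at this
      exact this
    exact eL.symm.injective (Subtype.ext (hu h1))
  have hwL : Function.Injective wL := by
    intro m m' hmm'
    have hT : T ⊆ w (σ (eL.symm m)) := (hσ _).mpr (eL.symm m).2
    have hT' : T ⊆ w (σ (eL.symm m')) := (hσ _).mpr (eL.symm m').2
    have h1 : w (σ (eL.symm m)) = w (σ (eL.symm m')) := by
      have := congrArg (· ∪ T) hmm'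
      simp only [wL, Finset.sdiff_union_of_subset hT, Finset.sdiff_union_of_subset hT'] at this
      exact this
    exact eL.symm.injective (Subtype.ext (σ.injective (hw h1)))
  have hluL : IsLowerSet (Set.range uL) := by
    rintro A B hBA ⟨m, rfl⟩
    -- B ⊆ (u i) − b₀, so insert b₀ B ⊆ u i is a row through b₀
    have hsub : insert b₀ B ⊆ u (eL.symm m) := by
      intro x hx
      rcases Finset.mem_insert.mp hx with rfl | hx
      · exact (eL.symm m).2
      · exact (Finset.mem_erase.mp (hBA hx)).2
    obtain ⟨i', hi'⟩ := hlu (show insert b₀ B ≤ u (eL.symm m) from hsub) ⟨_, rfl⟩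
    have hb' : b₀ ∈ u i' := by rw [hi']; exact Finset.mem_insert_self _ _
    have hb₀B : b₀ ∉ B := fun hx => (Finset.mem_erase.mp (hBA hx)).1 rfl
    refine ⟨eL ⟨i', hb'⟩, ?_⟩
    simp only [uL, Equiv.symm_apply_apply, hi', Finset.erase_insert hb₀B]
  have hlwL : IsLowerSet (Set.range wL) := by
    rintro S B hBS ⟨m, rfl⟩
    have hT : T ⊆ w (σ (eL.symm m)) := (hσ _).mpr (eL.symm m).2
    have hsub : B ∪ T ⊆ w (σ (eL.symm m)) := Finset.union_subset (fun x hx => (Finset.mem_sdiff.mp (hBS hx)).1) hT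
    obtain ⟨j', hj'⟩ := hlw (show B ∪ T ≤ w (σ (eL.symm m)) from hsub) ⟨_, rfl⟩
    have hTj' : T ⊆ w (σ (σ.symm j')) := by rw [Equiv.apply_symm_apply, hj']; exact Finset.subset_union_right
    have hbj : b₀ ∈ u (σ.symm j') := (hσ _).mp hTj'
    have hBT : Disjoint B T := Finset.disjoint_left.mpr fun x hx hxT => (Finset.mem_sdiff.mp (hBS hx)).2 hxT
    refine ⟨eL ⟨σ.symm j', hbj⟩, ?_⟩
    simp only [wL, Equiv.symm_apply_apply, Equiv.apply_symm_apply, hj', Finset.union_sdiff_cancel_right hBT]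
  obtain ⟨g₁, d₁, hdet₁⟩ := IH k hkr uL wL huL hwL hluL hlwL
  have Hlk : ∃ g d : Fin h → Fin h → ℂ,
      (Matrix.of fun i j : {i : Fin r // b₀ ∈ u i} => starEntry g d ((u i).erase b₀) ((w (σ j)) \ T)).det ≠ 0 := by
    refine ⟨g₁, d₁, ?_⟩
    have hmat : (Matrix.of fun i j : {i : Fin r // b₀ ∈ u i} => starEntry g₁ d₁ ((u i).erase b₀) ((w (σ j)) \ T))
        = Matrix.reindex eL.symm eL.symm (Matrix.of fun m m' : Fin k => starEntry g₁ d₁ (uL m) (wL m')) := by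
      ext i j
      simp only [Matrix.reindex_apply, Matrix.submatrix_apply, Matrix.of_apply, Equiv.symm_symm, uL, wL,
        Equiv.symm_apply_apply]
    rw [hmat, Matrix.det_reindex_self]
    exact hdet₁
  -- the DELETION pair
  let uD : Fin m₀ → Finset (Fin h) := fun m => u (eD.symm m)
  let wD : Fin m₀ → Finset (Fin h) := fun m => w (σ (eD.symm m))
  have huD : Function.Injective uD := fun m m' hmm' => eD.symm.injective (Subtype.ext (hu hmm'))
  have hwD : Function.Injective wD := fun m m' hmm' => eD.symm.injective (Subtype.ext (σ.injective (hw hmm')))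
  have hluD : IsLowerSet (Set.range uD) := by
    rintro A B hBA ⟨m, rfl⟩
    obtain ⟨i', hi'⟩ := hlu hBA ⟨_, rfl⟩
    have hb' : b₀ ∉ u i' := by rw [hi']; exact fun hx => (eD.symm m).2 (hBA hx)
    refine ⟨eD ⟨i', hb'⟩, ?_⟩
    simp only [uD, Equiv.symm_apply_apply, hi']
  have hlwD : IsLowerSet (Set.range wD) := by
    rintro S B hBS ⟨m, rfl⟩
    obtain ⟨j', hj'⟩ := hlw hBS ⟨_, rfl⟩
    have hnT : ¬ T ⊆ w (σ (σ.symm j')) := by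
      rw [Equiv.apply_symm_apply, hj']
      intro hTB
      exact (eD.symm m).2 ((hσ _).mp (hTB.trans hBS))
    have hnb : b₀ ∉ u (σ.symm j') := fun hb => hnT ((hσ _).mpr hb)
    refine ⟨eD ⟨σ.symm j', hnb⟩, ?_⟩
    simp only [wD, Equiv.symm_apply_apply, Equiv.apply_symm_apply, hj']
  obtain ⟨g₂, d₂, hdet₂⟩ := IH m₀ hm₀r uD wD huD hwD hluD hlwD
  have Hdl : ∃ g d : Fin h → Fin h → ℂ,
      (Matrix.of fun i j : {i : Fin r // b₀ ∉ u i} => starEntry g d (u i) (w (σ j))).det ≠ 0 := by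
    refine ⟨g₂, d₂, ?_⟩
    have hmat : (Matrix.of fun i j : {i : Fin r // b₀ ∉ u i} => starEntry g₂ d₂ (u i) (w (σ j)))
        = Matrix.reindex eD.symm eD.symm (Matrix.of fun m m' : Fin m₀ => starEntry g₂ d₂ (uD m) (wD m')) := by
      ext i j
      simp only [Matrix.reindex_apply, Matrix.submatrix_apply, Matrix.of_apply, Equiv.symm_symm, uD, wD,
        Equiv.symm_apply_apply]
    rw [hmat, Matrix.det_reindex_self]
    exact hdet₂
  exact starDet_ne_zero_of_facePivot u w b₀ T σ hσ Hlk Hdl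

end Step

end StarDoor

/-- **NODE TEXT (offered, D-0145): STAR-LOWER ON VERTEX–FACE-RIGID PAIRS.** For all `h`, `r` and every pair of injective enumerations `u`, `w` of
LOWER families that is vertex–face rigid (`StarDoor.IsFaceRigid`: no balanced vertex–face pivot on either side), some complex edge weights make the
star-forest block nonsingular. With `conjStarLower_of_conjStarRigid` below this is EQUIVALENT in strength to `Stmt.conjStarLower` for the purpose
of the door slot (the non-rigid pairs reduce to smaller pairs by the face pivot). WHY IT MIGHT FAIL: one rigid lower pair on which every block is
singular (none in the census of record: the 80 rigid ordered pairs on 5+5 vertices are all evaluation-face / vertex–facet certified). -/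
def Stmt.conjStarRigid : Prop :=
  ∀ (h r : ℕ) (u w : Fin r → Finset (Fin h)), Function.Injective u → Function.Injective w →
    IsLowerSet (Set.range u) → IsLowerSet (Set.range w) → StarDoor.IsFaceRigid u w →
    ∃ g d : Fin h → Fin h → ℂ, (Matrix.of fun i j : Fin r => StarDoor.starEntry g d (u i) (w j)).det ≠ 0

/-- **STAR-LOWER ⟸ STAR-LOWER ON RIGID PAIRS** (strong induction on `r`, peeling balanced vertex–face pivots on either side). -/
theorem conjStarLower_of_conjStarRigid (H : Stmt.conjStarRigid) : Stmt.conjStarLower := by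
  classical
  intro h r
  induction r using Nat.strong_induction_on with
  | _ r ih =>
    intro u w hu hw hlu hlw
    by_cases h1 : ∃ (b₀ : Fin h) (T : Finset (Fin h)), (∃ i, b₀ ∈ u i) ∧
        (Finset.univ.filter fun i => b₀ ∈ u i).card = (Finset.univ.filter fun j => T ⊆ w j).card
    · obtain ⟨b₀, T, hb₀, hcard⟩ := h1
      exact StarDoor.starDet_ne_zero_of_balanced_row u w ih hu hw hlu hlw b₀ T hb₀ hcard
    by_cases h2 : ∃ (e₀ : Fin h) (A₀ : Finset (Fin h)), (∃ j, e₀ ∈ w j) ∧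
        (Finset.univ.filter fun j => e₀ ∈ w j).card = (Finset.univ.filter fun i => A₀ ⊆ u i).card
    · -- column side: run the row step on the swapped pair `(w, u)` and swap back
      obtain ⟨e₀, A₀, he₀, hcard⟩ := h2
      have ih' : ∀ m < r, ∀ (u' w' : Fin m → Finset (Fin h)), Function.Injective u' → Function.Injective w' →
          IsLowerSet (Set.range u') → IsLowerSet (Set.range w') →
          ∃ g d : Fin h → Fin h → ℂ, (Matrix.of fun i j : Fin m => StarDoor.starEntry g d (u' i) (w' j)).det ≠ 0 :=
        fun m hm u' w' hu' hw' hlu' hlw' => ih m hm u' w' hu' hw' hlu' hlw'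
      obtain ⟨g', d', hdet⟩ := StarDoor.starDet_ne_zero_of_balanced_row w u ih' hw hu hlw hlu e₀ A₀ he₀ hcard
      refine ⟨fun b e => d' e b, fun b e => g' e b, ?_⟩
      have hmat : (Matrix.of fun i j : Fin r => StarDoor.starEntry (fun b e => d' e b) (fun b e => g' e b) (u i) (w j))
          = (Matrix.of fun i j : Fin r => StarDoor.starEntry g' d' (w i) (u j)).transpose := by
        ext i j
        simp only [Matrix.of_apply, Matrix.transpose_apply]
        rw [StarDoor.starEntry_swap]
      rw [hmat, Matrix.det_transpose]
      exact hdet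
    · push Not at h1 h2
      exact H h r u w hu hw hlu hlw ⟨fun b₀ T hb => h1 b₀ T hb, fun e₀ A₀ he => h2 e₀ A₀ he⟩

/-- **COMPOSITION BY NAME: `Stmt.conjStarRigid → AnchoredDoorHitsLowerPairs`** (through `Stmt.conjStarLower` and …StarArrow). -/
theorem anchoredDoorHitsLowerPairs_of_conjStarRigid (H : Stmt.conjStarRigid) :
    Summit.ValiantsHypothesis.ValiantsHypothesis.Theses.BarrierLever.AnchoredDoorHitsLowerPairs :=
  anchoredDoorHitsLowerPairs_of_conjStarLower (conjStarLower_of_conjStarRigid H)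

end

end Summit.ValiantsHypothesis.ValiantsHypothesis.Theorems.BarrierLever.AnchoredPeeling
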